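import Literature.Analysis.FunctionSpaces.LorentzPQ
import HarnessLib

/-!
# Dyadic discretisation of the Lorentz functional and dyadic layer bounds

Analysis/FunctionSpaces file, companion of `LorentzPQ.lean`.  For a measurable `f` with
distribution function `d_f(t) = μ{|f| > t}` write `d_k = d_f(2^k)`, `k ∈ ℤ`.  Three elementary
inequalities behind every "dyadic layer" manipulation of the Lorentz quasinorm
(Grafakos, *Classical Fourier Analysis*, 3rd ed.: the dyadic discretisation in the proof of
Lemma 1.4.20, `‖f‖_{L^{p,q}} ≳ ‖(2^k d_f(2^k)^{1/p})_k‖_{ℓ^q}`, and the layer decomposition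
`f = ∑_k f χ_{S_k}`, `S_k = {2^k ≤ |f| < 2^{k+1}}`, of Exercise 1.3.7 / (1.4.29)), all PROVED:

* `tsum_two_rpow_mul_measure_rpow_le_eLorentzNormPow` — the dyadic sequence is dominated by the
  functional: `∑_k 2^{kq} d_k^{q/p} ≤ 2^q · eLorentzNormPow f p q μ` for `1 ≤ q < ∞`
  (`d_f` is non-increasing: on `(2^{k-1}, 2^k]` the integrand `t^{q-1} d_f(t)^{q/p}` is at least
  `2^{(k-1)(q-1)} d_k^{q/p}`);
* `lintegral_enorm_layers_le_tsum` — the `L¹` size of the dyadic layers `2^k < |f| ≤ 2^{k+1}`,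
  `k ∈ H` (any `H ⊆ ℤ`): `∫_{X_H} ‖f‖ ≤ ∑_{k ∈ H} 2^{k+1} d_k`, where
  `X_H = {x | ∃ k ∈ H, 2^k < ‖f x‖ ≤ 2^{k+1}}`;
* `lintegral_enorm_rpow_layers_le_tsum` — the `L^r` size: `∫_{X_H} ‖f‖^r ≤ ∑_{k ∈ H} 2^{(k+1)r} d_k`
  (`0 < r`);
* `norm_sub_indicator_layers_le` — off `X_H` the field `f - 1_{X_H} f` lives on the complementary
  layers: `‖(f - 1_{X_H} f) x‖ ≤ 1_{X_{ℤ∖H}}(x) ‖f x‖` (every `x` with `f x ≠ 0` lies in exactly the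
  layer `k` with `2^k < ‖f x‖ ≤ 2^{k+1}`, `exists_mem_Ioc_zpow`).

Consumer: the embedding `L^{3,q}(ℝ³) ⊂ Ḃ^{-1+3/r}_{r,q}(ℝ³)`
(`Literature/Analysis/FluidPDE/LorentzBesovEmbedding.lean`), which splits `f` along dyadic layers
block by block.  No definitions are introduced (the sets `X_H` are written out).

## Mathlib / tree search

Tree: `LorentzPQ.lean`, `LorentzOne.lean`, `WeakLp.lean` (no dyadic lemmas); Mathlib:
`exists_mem_Ioc_zpow`, `MeasureTheory.lintegral_iUnion`, `MeasureTheory.lintegral_tsum`.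

## References

* L. Grafakos, *Classical Fourier Analysis*, 3rd ed., GTM 249 (2014), Prop. 1.4.9, proof of
  Lemma 1.4.20 (held text p0083), Exercise 1.3.7 (held text p0067), (1.4.29). [Grafakos2014]
-/

noncomputable section

open MeasureTheory Set Function Filter
open scoped ENNReal NNReal Topology

namespace Literature.Analysis.FunctionSpaces

variable {α : Type*} [MeasurableSpace α] {E : Type*} [NormedAddCommGroup E]
variable {f : α → E} {μ : Measure α}

/-- Cast helper: `ofReal (2^m) = 2^m` in `ℝ≥0∞` with a real exponent. [folklore] -/
private theorem lorentzDyadic_ofReal_two_zpow (m : ℤ) : ENNReal.ofReal ((2 : ℝ) ^ m) = (2 : ℝ≥0∞) ^ (m : ℝ) := by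
  rw [← Real.rpow_intCast, ← ENNReal.ofReal_rpow_of_pos two_pos, ENNReal.ofReal_ofNat]

/-- Cast helper: `ofReal (2^y) = 2^y` in `ℝ≥0∞` for a real exponent. [folklore] -/
private theorem lorentzDyadic_ofReal_two_rpow (y : ℝ) : ENNReal.ofReal ((2 : ℝ) ^ y) = (2 : ℝ≥0∞) ^ y := by
  rw [← ENNReal.ofReal_rpow_of_pos two_pos, ENNReal.ofReal_ofNat]

/-- `2^a · 2^b = 2^{a+b}` in `ℝ≥0∞` (real exponents). [folklore] -/
private theorem lorentzDyadic_two_rpow_mul (a b : ℝ) :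
    (2 : ℝ≥0∞) ^ a * (2 : ℝ≥0∞) ^ b = (2 : ℝ≥0∞) ^ (a + b) :=
  (ENNReal.rpow_add a b two_ne_zero ENNReal.ofNat_ne_top).symm

/-! ## The dyadic sequence is dominated by the Lorentz functional -/

/-- **Dyadic discretisation of the Lorentz functional** (Grafakos §1.4.2): for `1 ≤ q < ∞` and any
`p`, `∑_{k ∈ ℤ} 2^{kq} μ{2^k < ‖f‖}^{q/p} ≤ 2^q · eLorentzNormPow f p q μ`.  (On
`t ∈ (2^{k-1}, 2^k]` one has `t^{q-1} ≥ 2^{(k-1)(q-1)}` and `μ{t < ‖f‖} ≥ μ{2^k < ‖f‖}`, and the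
intervals are disjoint of length `2^{k-1}`; Grafakos, proof of Lemma 1.4.20:
`‖f‖^α_{L^{p,α}} = ∑_k ∫_{2^{k-1}}^{2^k} … ≥ ∑_k (2^{k-1})^{α/p} f^*(2^k)^α log 2`, here in the
distribution-function form of Prop. 1.4.9.) [cite: Grafakos2014, proof of Lemma 1.4.20 (dyadic discretisation of the L^{p,q} quasinorm) with Prop. 1.4.9] -/
theorem tsum_two_rpow_mul_measure_rpow_le_eLorentzNormPow (f : α → E) (μ : Measure α)
    {p q : ℝ≥0∞} (hq1 : 1 ≤ q) (hqtop : q ≠ ∞) :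
    ∑' k : ℤ, (2 : ℝ≥0∞) ^ ((k : ℝ) * q.toReal) *
        μ {x | (2 : ℝ) ^ k < ‖f x‖} ^ (q.toReal / p.toReal) ≤
      (2 : ℝ≥0∞) ^ q.toReal * eLorentzNormPow f p q μ := by
  have hq : 1 ≤ q.toReal := by
    rw [← ENNReal.toReal_one]
    exact (ENNReal.toReal_le_toReal ENNReal.one_ne_top hqtop).2 hq1
  set e : ℝ := q.toReal / p.toReal with he
  set I : ℤ → Set ℝ := fun k => Ioc ((2 : ℝ) ^ (k - 1)) ((2 : ℝ) ^ k) with hI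
  have hIm : ∀ k, MeasurableSet (I k) := fun k => measurableSet_Ioc
  have hId : Pairwise (Disjoint on I) := by
    intro k k' hkk'
    rcases lt_or_gt_of_ne hkk' with h | h
    · refine disjoint_left.2 fun t ht ht' => ?_
      have h1 : (2 : ℝ) ^ k ≤ (2 : ℝ) ^ (k' - 1) := zpow_le_zpow_right₀ one_le_two (by omega)
      exact absurd (lt_of_le_of_lt (ht.2.trans h1) ht'.1) (lt_irrefl _)
    · refine disjoint_left.2 fun t ht ht' => ?_
      have h1 : (2 : ℝ) ^ k' ≤ (2 : ℝ) ^ (k - 1) := zpow_le_zpow_right₀ one_le_two (by omega)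
      exact absurd (lt_of_le_of_lt (ht'.2.trans h1) ht.1) (lt_irrefl _)
  have hIsub : (⋃ k, I k) ⊆ Ioi (0 : ℝ) := by
    intro t ht
    obtain ⟨k, hk⟩ := mem_iUnion.1 ht
    exact lt_trans (zpow_pos two_pos _) hk.1
  have hpiece : ∀ k : ℤ,
      (2 : ℝ≥0∞) ^ (((k : ℝ) - 1) * q.toReal) * μ {x | (2 : ℝ) ^ k < ‖f x‖} ^ e ≤
        ∫⁻ t in I k, ENNReal.ofReal (t ^ (q.toReal - 1)) * μ {x | t < ‖f x‖} ^ e := by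
    intro k
    have hvol : volume (I k) = (2 : ℝ≥0∞) ^ ((k : ℝ) - 1) := by
      rw [hI]
      dsimp only
      rw [Real.volume_Ioc, show (2 : ℝ) ^ k - (2 : ℝ) ^ (k - 1) = (2 : ℝ) ^ (k - 1) by
        rw [zpow_sub_one₀ two_ne_zero]; ring, lorentzDyadic_ofReal_two_zpow]
      push_cast
      ring_nf
    have hconst : (2 : ℝ≥0∞) ^ (((k : ℝ) - 1) * q.toReal) =
        ENNReal.ofReal (((2 : ℝ) ^ (k - 1)) ^ (q.toReal - 1)) * volume (I k) := by
      rw [hvol, ← Real.rpow_intCast, ← Real.rpow_mul zero_le_two, lorentzDyadic_ofReal_two_rpow,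
        lorentzDyadic_two_rpow_mul]
      push_cast
      ring_nf
    calc (2 : ℝ≥0∞) ^ (((k : ℝ) - 1) * q.toReal) * μ {x | (2 : ℝ) ^ k < ‖f x‖} ^ e
        = ENNReal.ofReal (((2 : ℝ) ^ (k - 1)) ^ (q.toReal - 1)) *
            μ {x | (2 : ℝ) ^ k < ‖f x‖} ^ e * volume (I k) := by
          rw [hconst]; ring
      _ = ∫⁻ _ in I k, ENNReal.ofReal (((2 : ℝ) ^ (k - 1)) ^ (q.toReal - 1)) *
            μ {x | (2 : ℝ) ^ k < ‖f x‖} ^ e := by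
          rw [setLIntegral_const]
      _ ≤ ∫⁻ t in I k, ENNReal.ofReal (t ^ (q.toReal - 1)) * μ {x | t < ‖f x‖} ^ e := by
          refine setLIntegral_mono' (hIm k) fun t ht => ?_
          have ht0 : 0 ≤ (2 : ℝ) ^ (k - 1) := le_of_lt (zpow_pos two_pos _)
          have hq0 : 0 ≤ q.toReal - 1 := by linarith
          refine mul_le_mul' (ENNReal.ofReal_le_ofReal (Real.rpow_le_rpow ht0 ht.1.le hq0))
            (ENNReal.rpow_le_rpow (measure_mono fun x hx => lt_of_le_of_lt ht.2 hx)
              (by positivity))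
  calc ∑' k : ℤ, (2 : ℝ≥0∞) ^ ((k : ℝ) * q.toReal) * μ {x | (2 : ℝ) ^ k < ‖f x‖} ^ e
      = ∑' k : ℤ, (2 : ℝ≥0∞) ^ q.toReal *
          ((2 : ℝ≥0∞) ^ (((k : ℝ) - 1) * q.toReal) * μ {x | (2 : ℝ) ^ k < ‖f x‖} ^ e) := by
        refine tsum_congr fun k => ?_
        rw [← mul_assoc, lorentzDyadic_two_rpow_mul, show q.toReal + ((k : ℝ) - 1) * q.toReal =
          (k : ℝ) * q.toReal by ring]
    _ = (2 : ℝ≥0∞) ^ q.toReal *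
          ∑' k : ℤ, (2 : ℝ≥0∞) ^ (((k : ℝ) - 1) * q.toReal) * μ {x | (2 : ℝ) ^ k < ‖f x‖} ^ e :=
        ENNReal.tsum_mul_left
    _ ≤ (2 : ℝ≥0∞) ^ q.toReal *
          ∑' k : ℤ, ∫⁻ t in I k, ENNReal.ofReal (t ^ (q.toReal - 1)) * μ {x | t < ‖f x‖} ^ e := by
        gcongr with k
        exact hpiece k
    _ = (2 : ℝ≥0∞) ^ q.toReal *
          ∫⁻ t in ⋃ k, I k, ENNReal.ofReal (t ^ (q.toReal - 1)) * μ {x | t < ‖f x‖} ^ e := by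
        rw [lintegral_iUnion hIm hId]
    _ ≤ (2 : ℝ≥0∞) ^ q.toReal *
          ∫⁻ t in Ioi 0, ENNReal.ofReal (t ^ (q.toReal - 1)) * μ {x | t < ‖f x‖} ^ e := by
        exact mul_le_mul_right (lintegral_mono_set hIsub) _
    _ = (2 : ℝ≥0∞) ^ q.toReal * eLorentzNormPow f p q μ := by
        rw [eLorentzNormPow_eq_lintegral_setOf_lt_norm]

/-- Each dyadic value of the distribution function is controlled by the functional:
`2^{kq} μ{2^k < ‖f‖}^{q/p} ≤ 2^q · eLorentzNormPow f p q μ` (one term of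
`tsum_two_rpow_mul_measure_rpow_le_eLorentzNormPow`). [cite: Grafakos2014, proof of Lemma 1.4.20 with Prop. 1.4.9] -/
theorem two_rpow_mul_measure_rpow_le_eLorentzNormPow (f : α → E) (μ : Measure α)
    {p q : ℝ≥0∞} (hq1 : 1 ≤ q) (hqtop : q ≠ ∞) (k : ℤ) :
    (2 : ℝ≥0∞) ^ ((k : ℝ) * q.toReal) * μ {x | (2 : ℝ) ^ k < ‖f x‖} ^ (q.toReal / p.toReal) ≤
      (2 : ℝ≥0∞) ^ q.toReal * eLorentzNormPow f p q μ :=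
  le_trans (ENNReal.le_tsum (f := fun k : ℤ => (2 : ℝ≥0∞) ^ ((k : ℝ) * q.toReal) *
      μ {x | (2 : ℝ) ^ k < ‖f x‖} ^ (q.toReal / p.toReal)) k)
    (tsum_two_rpow_mul_measure_rpow_le_eLorentzNormPow f μ hq1 hqtop)

/-- In particular every dyadic superlevel set has finite measure when the functional is finite
and `0 < p, q < ∞`, `1 ≤ q`. [cite: Grafakos2014, proof of Lemma 1.4.20 with Prop. 1.4.9] -/
theorem measure_setOf_two_zpow_lt_norm_lt_top (f : α → E) (μ : Measure α) {p q : ℝ≥0∞}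
    (hp0 : p ≠ 0) (hptop : p ≠ ∞) (hq1 : 1 ≤ q) (hqtop : q ≠ ∞)
    (hf : eLorentzNormPow f p q μ < ∞) (k : ℤ) :
    μ {x | (2 : ℝ) ^ k < ‖f x‖} < ∞ := by
  have hp : 0 < p.toReal := ENNReal.toReal_pos hp0 hptop
  have hq : 0 < q.toReal :=
    ENNReal.toReal_pos (ne_of_gt (lt_of_lt_of_le zero_lt_one hq1)) hqtop
  have he : 0 < q.toReal / p.toReal := div_pos hq hp
  have h := two_rpow_mul_measure_rpow_le_eLorentzNormPow f μ (p := p) hq1 hqtop k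
  have hfin : (2 : ℝ≥0∞) ^ ((k : ℝ) * q.toReal) *
      μ {x | (2 : ℝ) ^ k < ‖f x‖} ^ (q.toReal / p.toReal) < ∞ :=
    lt_of_le_of_lt h (ENNReal.mul_lt_top (ENNReal.rpow_lt_top_of_nonneg hq.le
      ENNReal.ofNat_ne_top) hf)
  have hne : (2 : ℝ≥0∞) ^ ((k : ℝ) * q.toReal) ≠ 0 :=
    ne_of_gt (ENNReal.rpow_pos two_pos ENNReal.ofNat_ne_top)
  have hpow : μ {x | (2 : ℝ) ^ k < ‖f x‖} ^ (q.toReal / p.toReal) < ∞ := by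
    by_contra hc
    rw [not_lt, top_le_iff] at hc
    rw [hc, ENNReal.mul_top hne] at hfin
    exact lt_irrefl _ hfin
  by_contra hc
  rw [not_lt, top_le_iff] at hc
  rw [hc, ENNReal.top_rpow_of_pos he] at hpow
  exact lt_irrefl _ hpow

/-! ## Dyadic layers -/

/-- Every nonzero vector lies in a dyadic layer `2^k < ‖v‖ ≤ 2^{k+1}` (`exists_mem_Ioc_zpow`;
the layers `S_k` of Grafakos, Exercise 1.3.7, hint). [cite: Grafakos2014, Exercise 1.3.7 (hint: f = ∑_k f χ_{S_k}, S_k the dyadic layers)] -/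
theorem exists_two_zpow_lt_norm_le {v : E} (hv : v ≠ 0) :
    ∃ k : ℤ, (2 : ℝ) ^ k < ‖v‖ ∧ ‖v‖ ≤ (2 : ℝ) ^ (k + 1) := by
  obtain ⟨k, hk⟩ := exists_mem_Ioc_zpow (norm_pos_iff.2 hv) one_lt_two
  exact ⟨k, hk.1, hk.2⟩

/-- **`L¹` size of a family of dyadic layers**: for any `H ⊆ ℤ`,
`∫ ‖1_{X_H} f‖ dμ ≤ ∑_{k ∈ H} 2^{k+1} μ{2^k < ‖f‖}`, `X_H = {x | ∃ k ∈ H, 2^k < ‖f x‖ ≤ 2^{k+1}}`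
(on the layer `k`, `‖f‖ ≤ 2^{k+1}` and the layer is contained in `{2^k < ‖f‖}`).  `f` is assumed
a.e.-strongly measurable (so that the superlevel sets are null-measurable).
[cite: Grafakos2014, Exercise 1.3.7 (hint: f = ∑_k f χ_{S_k}) and (1.4.29)] -/
theorem lintegral_enorm_layers_le_tsum (hf : AEStronglyMeasurable f μ) (H : Set ℤ) :
    ∫⁻ x, ‖{x | ∃ k ∈ H, (2 : ℝ) ^ k < ‖f x‖ ∧ ‖f x‖ ≤ (2 : ℝ) ^ (k + 1)}.indicator f x‖ₑ ∂μ ≤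
      ∑' k : ℤ, H.indicator
        (fun k => (2 : ℝ≥0∞) ^ ((k : ℝ) + 1) * μ {x | (2 : ℝ) ^ k < ‖f x‖}) k := by
  classical
  set X : Set α := {x | ∃ k ∈ H, (2 : ℝ) ^ k < ‖f x‖ ∧ ‖f x‖ ≤ (2 : ℝ) ^ (k + 1)} with hX
  -- the summands as functions of `x`
  set g : ℤ → α → ℝ≥0∞ := fun k x =>
    H.indicator (fun k => (2 : ℝ≥0∞) ^ ((k : ℝ) + 1) *
      {x | (2 : ℝ) ^ k < ‖f x‖}.indicator (1 : α → ℝ≥0∞) x) k with hg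
  have hnull : ∀ k : ℤ, NullMeasurableSet {x | (2 : ℝ) ^ k < ‖f x‖} μ := fun k =>
    nullMeasurableSet_lt aemeasurable_const hf.norm.aemeasurable
  have hgm : ∀ k, AEMeasurable (g k) μ := by
    intro k
    by_cases hk : k ∈ H
    · simp only [hg, indicator_of_mem hk]
      exact (aemeasurable_const.indicator₀ (hnull k)).const_mul _
    · simp only [hg, indicator_of_notMem hk]
      exact aemeasurable_const
  -- pointwise bound
  have hpt : ∀ x, ‖X.indicator f x‖ₑ ≤ ∑' k, g k x := by
    intro x
    by_cases hx : x ∈ X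
    · rw [indicator_of_mem hx]
      obtain ⟨k, hkH, hk1, hk2⟩ := hx
      refine le_trans ?_ (ENNReal.le_tsum k)
      have hmem : x ∈ {x | (2 : ℝ) ^ k < ‖f x‖} := hk1
      simp only [hg, indicator_of_mem hkH, indicator_of_mem hmem, Pi.one_apply, mul_one]
      calc ‖f x‖ₑ = ENNReal.ofReal ‖f x‖ := (ofReal_norm (f x)).symm
        _ ≤ ENNReal.ofReal ((2 : ℝ) ^ (k + 1)) := ENNReal.ofReal_le_ofReal hk2
        _ = (2 : ℝ≥0∞) ^ ((k : ℝ) + 1) := by rw [lorentzDyadic_ofReal_two_zpow]; push_cast; ring_nf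
    · rw [indicator_of_notMem hx, enorm_zero]
      exact bot_le
  calc ∫⁻ x, ‖X.indicator f x‖ₑ ∂μ
      ≤ ∫⁻ x, ∑' k, g k x ∂μ := lintegral_mono hpt
    _ = ∑' k, ∫⁻ x, g k x ∂μ := lintegral_tsum hgm
    _ = ∑' k : ℤ, H.indicator
          (fun k => (2 : ℝ≥0∞) ^ ((k : ℝ) + 1) * μ {x | (2 : ℝ) ^ k < ‖f x‖}) k := by
        refine tsum_congr fun k => ?_
        by_cases hk : k ∈ H
        · simp only [hg, indicator_of_mem hk]
          rw [lintegral_const_mul'' _ ((measurable_one (α := ℝ≥0∞)).aemeasurable.indicator₀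
            (hnull k)), lintegral_indicator_one₀ (hnull k)]
        · simp only [hg, indicator_of_notMem hk, lintegral_zero]

/-- **`L^r` size of a family of dyadic layers** (`0 < r`): for any `H ⊆ ℤ`,
`∫ ‖1_{X_H} f‖^r dμ ≤ ∑_{k ∈ H} 2^{(k+1)r} μ{2^k < ‖f‖}`.
[cite: Grafakos2014, Exercise 1.3.7 (hint: f = ∑_k f χ_{S_k}) and (1.4.29)] -/
theorem lintegral_enorm_rpow_layers_le_tsum (hf : AEStronglyMeasurable f μ) (H : Set ℤ) {r : ℝ}
    (hr : 0 < r) :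
    ∫⁻ x, ‖{x | ∃ k ∈ H, (2 : ℝ) ^ k < ‖f x‖ ∧ ‖f x‖ ≤ (2 : ℝ) ^ (k + 1)}.indicator f x‖ₑ ^ r ∂μ ≤
      ∑' k : ℤ, H.indicator
        (fun k => (2 : ℝ≥0∞) ^ (((k : ℝ) + 1) * r) * μ {x | (2 : ℝ) ^ k < ‖f x‖}) k := by
  classical
  set X : Set α := {x | ∃ k ∈ H, (2 : ℝ) ^ k < ‖f x‖ ∧ ‖f x‖ ≤ (2 : ℝ) ^ (k + 1)} with hX
  set g : ℤ → α → ℝ≥0∞ := fun k x =>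
    H.indicator (fun k => (2 : ℝ≥0∞) ^ (((k : ℝ) + 1) * r) *
      {x | (2 : ℝ) ^ k < ‖f x‖}.indicator (1 : α → ℝ≥0∞) x) k with hg
  have hnull : ∀ k : ℤ, NullMeasurableSet {x | (2 : ℝ) ^ k < ‖f x‖} μ := fun k =>
    nullMeasurableSet_lt aemeasurable_const hf.norm.aemeasurable
  have hgm : ∀ k, AEMeasurable (g k) μ := by
    intro k
    by_cases hk : k ∈ H
    · simp only [hg, indicator_of_mem hk]
      exact (aemeasurable_const.indicator₀ (hnull k)).const_mul _
    · simp only [hg, indicator_of_notMem hk]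
      exact aemeasurable_const
  have hpt : ∀ x, ‖X.indicator f x‖ₑ ^ r ≤ ∑' k, g k x := by
    intro x
    by_cases hx : x ∈ X
    · rw [indicator_of_mem hx]
      obtain ⟨k, hkH, hk1, hk2⟩ := hx
      refine le_trans ?_ (ENNReal.le_tsum k)
      have hmem : x ∈ {x | (2 : ℝ) ^ k < ‖f x‖} := hk1
      simp only [hg, indicator_of_mem hkH, indicator_of_mem hmem, Pi.one_apply, mul_one]
      calc ‖f x‖ₑ ^ r = ENNReal.ofReal ‖f x‖ ^ r := by rw [ofReal_norm]
        _ ≤ ENNReal.ofReal ((2 : ℝ) ^ (k + 1)) ^ r :=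
            ENNReal.rpow_le_rpow (ENNReal.ofReal_le_ofReal hk2) hr.le
        _ = (2 : ℝ≥0∞) ^ (((k : ℝ) + 1) * r) := by
            rw [lorentzDyadic_ofReal_two_zpow, ← ENNReal.rpow_mul]; push_cast; ring_nf
    · rw [indicator_of_notMem hx, enorm_zero, ENNReal.zero_rpow_of_pos hr]
      exact bot_le
  calc ∫⁻ x, ‖X.indicator f x‖ₑ ^ r ∂μ
      ≤ ∫⁻ x, ∑' k, g k x ∂μ := lintegral_mono hpt
    _ = ∑' k, ∫⁻ x, g k x ∂μ := lintegral_tsum hgm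
    _ = ∑' k : ℤ, H.indicator
          (fun k => (2 : ℝ≥0∞) ^ (((k : ℝ) + 1) * r) * μ {x | (2 : ℝ) ^ k < ‖f x‖}) k := by
        refine tsum_congr fun k => ?_
        by_cases hk : k ∈ H
        · simp only [hg, indicator_of_mem hk]
          rw [lintegral_const_mul'' _ ((measurable_one (α := ℝ≥0∞)).aemeasurable.indicator₀
            (hnull k)), lintegral_indicator_one₀ (hnull k)]
        · simp only [hg, indicator_of_notMem hk, lintegral_zero]

omit [MeasurableSpace α] in
/-- **The complementary layers carry the rest of `f`**: for any `H ⊆ ℤ` and every `x`,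
`‖(f - 1_{X_H} f) x‖ ≤ ‖1_{X_{ℤ∖H}} f x‖` — a nonzero value `f x` outside the layers indexed by
`H` lies in a layer indexed by `Hᶜ` (`exists_mem_Ioc_zpow`; Grafakos, Exercise 1.3.7, hint:
`f = ∑_k f χ_{S_k}`). [cite: Grafakos2014, Exercise 1.3.7 (hint: f = ∑_k f χ_{S_k})] -/
theorem norm_sub_indicator_layers_le (f : α → E) (H : Set ℤ) (x : α) :
    ‖(f - {x | ∃ k ∈ H, (2 : ℝ) ^ k < ‖f x‖ ∧ ‖f x‖ ≤ (2 : ℝ) ^ (k + 1)}.indicator f) x‖ ≤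
      ‖{x | ∃ k ∈ Hᶜ, (2 : ℝ) ^ k < ‖f x‖ ∧ ‖f x‖ ≤ (2 : ℝ) ^ (k + 1)}.indicator f x‖ := by
  classical
  set X : Set α := {x | ∃ k ∈ H, (2 : ℝ) ^ k < ‖f x‖ ∧ ‖f x‖ ≤ (2 : ℝ) ^ (k + 1)} with hX
  set Y : Set α := {x | ∃ k ∈ Hᶜ, (2 : ℝ) ^ k < ‖f x‖ ∧ ‖f x‖ ≤ (2 : ℝ) ^ (k + 1)} with hY
  by_cases hx : x ∈ X
  · simp [indicator_of_mem hx]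
  · rw [Pi.sub_apply, indicator_of_notMem hx, sub_zero]
    by_cases h0 : f x = 0
    · simp [h0]
    · obtain ⟨k, hk1, hk2⟩ := exists_two_zpow_lt_norm_le h0
      have hkH : k ∈ Hᶜ := fun hkH => hx ⟨k, hkH, hk1, hk2⟩
      have hy : x ∈ Y := ⟨k, hkH, hk1, hk2⟩
      rw [indicator_of_mem hy]

omit [MeasurableSpace α] in
/-- The two truncations recompose `f`: `1_{X_H} f + (f - 1_{X_H} f) = f` (Grafakos, Exercise 1.3.7,
hint). [cite: Grafakos2014, Exercise 1.3.7 (hint: f = ∑_k f χ_{S_k})] -/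
theorem indicator_layers_add_sub (f : α → E) (H : Set ℤ) :
    {x | ∃ k ∈ H, (2 : ℝ) ^ k < ‖f x‖ ∧ ‖f x‖ ≤ (2 : ℝ) ^ (k + 1)}.indicator f +
      (f - {x | ∃ k ∈ H, (2 : ℝ) ^ k < ‖f x‖ ∧ ‖f x‖ ≤ (2 : ℝ) ^ (k + 1)}.indicator f) = f :=
  add_sub_cancel _ _

end Literature.Analysis.FunctionSpaces

end
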